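import Summits.ValiantsHypothesis.ValiantsHypothesis.Theorems.RigidityForcesSymmetryGrenetFirstOrderRankRigidWeightZero

/-!
# Route RigidityForcesSymmetry — `GrenetFirstOrderRankRigid` (item stmt-ValiantsHypothesis-21029),
line `grenet_gauge`: stub `stub_linearRigid`, step 5 (block II) — the entries of an overlap block
`(A, k)` with `T ⊊ U`

For the crux line `Cruxes/GrenetFirstOrderRankRigid/Lines/grenet_gauge.lean` (blueprint
`Lines/grenet_gauge-stub_linearRigid-PROOF.md`, §5, block II).  With the indicator torus weights,
the block of a pair `(U, T)` with `T ⊊ U`, `A := U \\ T` (`a = |A| ≥ 1`), `k := |T|`, `u := a + k`, has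
the weight `inl j ↦ 1 + [j ∈ A]`, `inr c ↦ 1 + [k ≤ c < u]`.  This file identifies its entries:

* `blockII_tail_shape` — a TAIL entry (`p ∉ S`, `q = |S|`) of this weight has `T ⊆ Aᶜ`, `|T| = k`,
  `S + p = A ⊔ T`, `q = u - 1` (it is `ρ[T, p]` of the blueprint);
* `blockII_head_shape` — a HEAD entry (`p ∈ T`, `|T| = q + 1`) of this weight has `T - p ⊆ Aᶜ`,
  `|T - p| = k`, `S = A ⊔ (T - p)`, `q = k` (it is `κ[T - p, p]`);
* `blockII_weight_of_tail`, `blockII_weight_of_head` — conversely these entries have the block weight.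

No new definitions.  VP ≠ VNP is not moved by this file.
-/

noncomputable section

open MvPolynomial Matrix Finset

namespace Summit.ValiantsHypothesis.Theorems.RigidityForcesSymmetry.GrenetGauge

open Literature.Computability.AlgebraicComplexity

variable {n : ℕ}

/-- The indicator entry weight as a function (pointwise form of `weightE_apply_inl/inr`). [folklore] -/
theorem weightE_eq_iff (S T : Finset (Fin n)) (v : Fin n × Fin n) (m : Fin n ⊕ Fin n → ℕ) :
    ((∑ j ∈ S, (Pi.single (Sum.inl j) 1 : Fin n ⊕ Fin n → ℕ) + ∑ j ∈ Tᶜ, (Pi.single (Sum.inl j) 1 : Fin n ⊕ Fin n → ℕ)) +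
        (∑ c ∈ univ.filter (fun c : Fin n => (c : ℕ) < S.card), (Pi.single (Sum.inr c) 1 : Fin n ⊕ Fin n → ℕ)
          + ∑ c ∈ univ.filter (fun c : Fin n => T.card ≤ (c : ℕ)), (Pi.single (Sum.inr c) 1 : Fin n ⊕ Fin n → ℕ))
        + ((Pi.single (Sum.inl v.1) 1 : Fin n ⊕ Fin n → ℕ) + (Pi.single (Sum.inr v.2) 1 : Fin n ⊕ Fin n → ℕ)))
      = m ↔
      (∀ j' : Fin n, (if j' ∈ S then 1 else 0) + (if j' ∈ T then 0 else 1) + (if j' = v.1 then 1 else 0) = m (Sum.inl j')) ∧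
      (∀ c' : Fin n, (if (c' : ℕ) < S.card then 1 else 0) + (if T.card ≤ (c' : ℕ) then 1 else 0)
        + (if c' = v.2 then 1 else 0) = m (Sum.inr c')) := by
  constructor
  · intro h
    exact ⟨fun j' => by rw [← weightE_apply_inl S T v j', h], fun c' => by rw [← weightE_apply_inr S T v c', h]⟩
  · rintro ⟨h1, h2⟩
    funext x
    cases x with
    | inl j' => rw [weightE_apply_inl]; exact h1 j'
    | inr c' => rw [weightE_apply_inr]; exact h2 c'

/-- **Columns of the overlap block.**  If `[c' < s] + [t ≤ c'] + [c' = q] = 1 + [k ≤ c' < u]` for all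
columns `c' < n`, with `k < u ≤ n` and `q < n`, then `(s, t, q) = (u - 1, k, u - 1)` (when `q = s`:
tail shape) or `(s, t, q) = (u, k + 1, k)` (when `t = q + 1`: head shape). [folklore] -/
theorem blockII_column_shape {s t k u : ℕ} (hku : k < u) (hun : u ≤ n) (hs : s ≤ n) (q : Fin n)
    (hcol : ∀ c' : Fin n, (if (c' : ℕ) < s then 1 else 0) + (if t ≤ (c' : ℕ) then 1 else 0)
      + (if c' = q then 1 else 0) = 1 + (if k ≤ (c' : ℕ) ∧ (c' : ℕ) < u then 1 else 0)) :
    ((q : ℕ) = s → t = k ∧ s = u - 1) ∧ (t = (q : ℕ) + 1 → t = k + 1 ∧ s = u) := by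
  -- the weight of a column `c' ≠ q`
  have hoff1 : ∀ c' : Fin n, c' ≠ q → (c' : ℕ) < s → t ≤ (c' : ℕ) → (k ≤ (c' : ℕ) ∧ (c' : ℕ) < u) := by
    intro c' hc' h1 h2; have h := hcol c'; rw [if_neg hc'] at h; split_ifs at h <;> omega
  have hoff2 : ∀ c' : Fin n, c' ≠ q → k ≤ (c' : ℕ) → (c' : ℕ) < u → ((c' : ℕ) < s ∧ t ≤ (c' : ℕ)) := by
    intro c' hc' h1 h2; have h := hcol c'; rw [if_neg hc'] at h; split_ifs at h <;> omega
  -- the weight of the column `q`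
  have hq1 : ¬ ((q : ℕ) < s ∧ t ≤ (q : ℕ)) := by
    intro h'; have h := hcol q; rw [if_pos rfl] at h; split_ifs at h <;> omega
  have hq2 : ((q : ℕ) < s ∨ t ≤ (q : ℕ)) → (k ≤ (q : ℕ) ∧ (q : ℕ) < u) := by
    intro h'; have h := hcol q; rw [if_pos rfl] at h; split_ifs at h <;> omega
  have hq3 : (k ≤ (q : ℕ) ∧ (q : ℕ) < u) → ((q : ℕ) < s ∨ t ≤ (q : ℕ)) := by
    intro h'; have h := hcol q; rw [if_pos rfl] at h; split_ifs at h <;> omega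
  have hqn := q.isLt
  have hne : ∀ c : ℕ, ∀ hc : c < n, c ≠ (q : ℕ) → (⟨c, hc⟩ : Fin n) ≠ q := fun c hc h h' =>
    h (by rw [← h'])
  constructor
  · intro hqs
    have hts : t ≤ s := by
      by_contra hts
      have hno : ¬ (k ≤ (q : ℕ) ∧ (q : ℕ) < u) := fun h => by
        rcases hq3 h with h' | h' <;> omega
      by_cases hkq : k = (q : ℕ)
      · exact hno ⟨by omega, by omega⟩
      · have := hoff2 ⟨k, by omega⟩ (hne k (by omega) hkq) le_rfl hku
        simp only at this; omega
    have hkq : k ≤ (q : ℕ) ∧ (q : ℕ) < u := hq2 (Or.inr (by omega))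
    constructor
    · by_contra htk
      rcases Nat.lt_or_gt_of_ne htk with h | h
      · have := hoff1 ⟨t, by omega⟩ (hne t (by omega) (by omega)) (by simp only; omega) (by simp only; exact le_rfl)
        simp only at this; omega
      · have := hoff2 ⟨k, by omega⟩ (hne k (by omega) (by omega)) (by simp only; exact le_rfl) (by simp only; omega)
        simp only at this; omega
    · by_contra hsu'
      have := hoff2 ⟨s + 1, by omega⟩ (hne (s + 1) (by omega) (by omega)) (by simp only; omega) (by simp only; omega)
      simp only at this; omega
  · intro htq
    have hqs : (q : ℕ) < s := by
      by_contra hqs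
      have hno : ¬ (k ≤ (q : ℕ) ∧ (q : ℕ) < u) := fun h => by
        rcases hq3 h with h' | h' <;> omega
      by_cases huq : u - 1 = (q : ℕ)
      · exact hno ⟨by omega, by omega⟩
      · have := hoff2 ⟨u - 1, by omega⟩ (hne (u - 1) (by omega) huq) (by simp only; omega) (by simp only; omega)
        simp only at this; omega
    have hkq : k ≤ (q : ℕ) ∧ (q : ℕ) < u := hq2 (Or.inl hqs)
    constructor
    · by_contra h
      have := hoff2 ⟨k, by omega⟩ (hne k (by omega) (by omega)) (by simp only; exact le_rfl) (by simp only; omega)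
      simp only at this; omega
    · have h1 : u ≤ s := by
        by_cases huq : u - 1 = (q : ℕ)
        · omega
        · have := hoff2 ⟨u - 1, by omega⟩ (hne (u - 1) (by omega) huq) (by simp only; omega) (by simp only; omega)
          simp only at this; omega
      have h2 : s ≤ u := by
        by_contra h2
        by_cases hun' : u < n
        · have := hoff1 ⟨u, hun'⟩ (hne u hun' (by omega)) (by simp only; omega) (by simp only; omega)
          simp only at this; omega
        · omega
      omega

/-- **Tail entries of the overlap block `(A, k)`.**  If a tail entry `(S, T, (p, q))` (`p ∉ S`,
`q = |S|`) has the indicator weight `inl j ↦ 1 + [j ∈ A]`, `inr c ↦ 1 + [k ≤ c < a + k]` with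
`a = |A| ≥ 1`, `a + k ≤ n`, then `T ⊆ Aᶜ`, `|T| = k`, `S + p = A ∪ T` and `q = a + k - 1`. [folklore] -/
theorem blockII_tail_shape (A S T : Finset (Fin n)) (k : ℕ) (hA : 0 < A.card) (hu : A.card + k ≤ n)
    (v : Fin n × Fin n) (ht : v.1 ∉ S ∧ (v.2 : ℕ) = S.card)
    (hrow : ∀ j' : Fin n, (if j' ∈ S then 1 else 0) + (if j' ∈ T then 0 else 1) + (if j' = v.1 then 1 else 0)
      = 1 + (if j' ∈ A then 1 else 0))
    (hcol : ∀ c' : Fin n, (if (c' : ℕ) < S.card then 1 else 0) + (if T.card ≤ (c' : ℕ) then 1 else 0)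
      + (if c' = v.2 then 1 else 0) = 1 + (if k ≤ (c' : ℕ) ∧ (c' : ℕ) < A.card + k then 1 else 0)) :
    T ⊆ Aᶜ ∧ T.card = k ∧ insert v.1 S = A ∪ T ∧ (v.2 : ℕ) = A.card + k - 1 := by
  obtain ⟨hTk, hSu⟩ := (blockII_column_shape (by omega) hu ((Finset.card_le_univ S).trans_eq (Fintype.card_fin n)) v.2 hcol).1 ht.2
  -- rows: `[j ∈ S + p] + [j ∉ T] = 1 + [j ∈ A]`
  have hrow' : ∀ j' : Fin n, (if j' ∈ insert v.1 S then 1 else 0) + (if j' ∈ T then 0 else 1)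
      = 1 + (if j' ∈ A then 1 else 0) := by
    intro j'
    have := hrow j'
    by_cases h1 : j' = v.1
    · subst h1
      rw [if_neg ht.1, if_pos rfl] at this
      rw [if_pos (Finset.mem_insert_self _ _)]; omega
    · rw [if_neg h1] at this
      by_cases h2 : j' ∈ S
      · rw [if_pos h2] at this; rw [if_pos (Finset.mem_insert_of_mem h2)]; omega
      · rw [if_neg h2] at this; rw [if_neg (fun h => (Finset.mem_insert.mp h).elim h1 h2)]; omega
  refine ⟨fun x hxT => ?_, hTk, ?_, by rw [ht.2, hSu]⟩
  · rw [Finset.mem_compl]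
    intro hxA
    have := hrow' x
    rw [if_pos hxT, if_pos hxA] at this
    split_ifs at this <;> omega
  · ext x
    have := hrow' x
    rw [Finset.mem_union]
    constructor
    · intro hx
      rw [if_pos hx] at this
      by_cases hxA : x ∈ A
      · exact Or.inl hxA
      · rw [if_neg hxA] at this
        by_cases hxT : x ∈ T
        · exact Or.inr hxT
        · rw [if_neg hxT] at this; omega
    · intro hx
      by_contra hx'
      rw [if_neg hx'] at this
      rcases hx with hxA | hxT
      · rw [if_pos hxA] at this; split_ifs at this <;> omega
      · rw [if_pos hxT] at this; split_ifs at this <;> omega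

/-- **Head entries of the overlap block `(A, k)`.**  If a head entry `(S, T, (p, q))` (`p ∈ T`,
`|T| = q + 1`) has the block weight (`a = |A| ≥ 1`, `a + k ≤ n`), then `T - p ⊆ Aᶜ`, `|T - p| = k`,
`S = A ∪ (T - p)` and `q = k`. [folklore] -/
theorem blockII_head_shape (A S T : Finset (Fin n)) (k : ℕ) (hA : 0 < A.card) (hu : A.card + k ≤ n)
    (v : Fin n × Fin n) (hh : v.1 ∈ T ∧ T.card = (v.2 : ℕ) + 1)
    (hrow : ∀ j' : Fin n, (if j' ∈ S then 1 else 0) + (if j' ∈ T then 0 else 1) + (if j' = v.1 then 1 else 0)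
      = 1 + (if j' ∈ A then 1 else 0))
    (hcol : ∀ c' : Fin n, (if (c' : ℕ) < S.card then 1 else 0) + (if T.card ≤ (c' : ℕ) then 1 else 0)
      + (if c' = v.2 then 1 else 0) = 1 + (if k ≤ (c' : ℕ) ∧ (c' : ℕ) < A.card + k then 1 else 0)) :
    T.erase v.1 ⊆ Aᶜ ∧ (T.erase v.1).card = k ∧ S = A ∪ T.erase v.1 ∧ (v.2 : ℕ) = k := by
  obtain ⟨hTk, hSu⟩ := (blockII_column_shape (by omega) hu ((Finset.card_le_univ S).trans_eq (Fintype.card_fin n)) v.2 hcol).2 hh.2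
  -- rows: `[j ∈ S] + [j ∉ T - p] = 1 + [j ∈ A] + [j = p]`… i.e. `[j ∈ S] = [j ∈ A] + [j ∈ T - p]`
  have hrow' : ∀ j' : Fin n, (if j' ∈ S then 1 else 0) = (if j' ∈ A then 1 else 0) + (if j' ∈ T.erase v.1 then 1 else 0) := by
    intro j'
    have := hrow j'
    by_cases h1 : j' = v.1
    · subst h1
      rw [if_pos hh.1, if_pos rfl] at this
      rw [if_neg (Finset.notMem_erase _ _)]; omega
    · rw [if_neg h1] at this
      by_cases h2 : j' ∈ T
      · rw [if_pos h2] at this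
        rw [if_pos (Finset.mem_erase.mpr ⟨h1, h2⟩)]; omega
      · rw [if_neg h2] at this
        rw [if_neg (fun h => h2 (Finset.mem_of_mem_erase h))]; omega
  refine ⟨fun x hx => ?_, by rw [Finset.card_erase_of_mem hh.1]; omega, ?_, by omega⟩
  · rw [Finset.mem_compl]
    intro hxA
    have := hrow' x
    rw [if_pos hxA, if_pos hx] at this
    split_ifs at this; omega
  · ext x
    have := hrow' x
    rw [Finset.mem_union]
    constructor
    · intro hx
      rw [if_pos hx] at this
      by_cases hxA : x ∈ A
      · exact Or.inl hxA
      · rw [if_neg hxA] at this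
        by_cases hxT : x ∈ T.erase v.1
        · exact Or.inr hxT
        · rw [if_neg hxT] at this; omega
    · intro hx
      by_contra hx'
      rw [if_neg hx'] at this
      rcases hx with hxA | hxT
      · rw [if_pos hxA] at this; omega
      · rw [if_pos hxT] at this; omega

end Summit.ValiantsHypothesis.Theorems.RigidityForcesSymmetry.GrenetGauge
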